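import Mathlib
import Summits.Ventures.PercRepro2.HCovOEdgeNormChord

/-!
# (MIN-END): no interior minimum of the functional along an edge at `a₃` (blind cell PercRepro2,
night-1 g18; NIGHT1-G18.md §6 — a candidate row, census-true)

Along any edge `f ∋ a₃` the mean field `q ↦ HMFc(p[f ↦ q])` and the covariance form
`q ↦ Gc(p[f ↦ q])` are cubic polynomials (every mass is affine in `q`).  The candidate row
**(MIN-END)** says they never dip below both endpoint values:
`min (HMFc (p[f ↦ 0])) (HMFc (p[f ↦ 1])) ≤ HMFc p` (and the same for `Gc`) — for every finite graph,
every weight vector, every edge `f` at `a₃`, whatever its other end (a mark or an unmarked vertex).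
Exact census: 661 / 661 locally (the four edge types, both functionals), kit j262775; the plain chord
`(1 − q) F(0) + q F(1) ≤ F(q)` FAILS on a sizeable fraction, so (MIN-END) is the weaker, correct
statement.

* `MinEndHMF_all`, `MinEndHCov_all`: the typed rows;
* **`HMF_of_minEnd`** / **`HCov_of_minEnd`**: the one-step reduction — (MIN-END) at `f` and the
  functional at both ends give the functional at `p`.

READING. With (MIN-END) at every edge at `a₃`, (HMF) (hence (HCOV), hence the chain of record)
follows for every instance by induction: deleting `f` (`q = 0`) or making it sure (`q = 1`) both
lower the number of edges of weight in `(0, 1)`; a sure edge to a mark is a coincidence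
(`Coinc.HMFc_a3_eq_a1/a2/o = 0`, `CoincA3HMF.HMF_a3_eq_b`), a sure edge to an unmarked `u` relabels
`a₃ := u` (`SureEdge.HMFc_sure`), and an `a₃` whose cluster is deterministic and unmarked has
`HMFc = 0` (the isolated case `HMFIsolated.HMFc_isolated` generalised).  The induction itself is not
formalised here.  Own code; standard axioms.
-/

namespace Summit.Ventures.PercRepro2

open UnionCluster CovForm

namespace MinEnd

section Row

variable (R : Type*) [Field R] [LinearOrder R] [IsStrictOrderedRing R]

/-- **(MIN-END) for the mean field**: along every edge at `a₃` the cubic `HMFc` attains its minimum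
over `[0, 1]` at an endpoint. -/
def MinEndHMF_all : Prop :=
  ∀ (V E : Type) [Fintype V] [DecidableEq V] [Fintype E] [DecidableEq E]
    (ends : E → Sym2 V) (p : E → R), IsProbVec p →
    ∀ (o a₁ a₂ a₃ b : V) (f : E), a₃ ∈ ends f →
      min (HMFc (Function.update p f 0) ends o a₁ a₂ a₃ b)
          (HMFc (Function.update p f 1) ends o a₁ a₂ a₃ b) ≤ HMFc p ends o a₁ a₂ a₃ b

/-- **(MIN-END) for the covariance form**: along every edge at `a₃` the cubic `Gc` attains its
minimum over `[0, 1]` at an endpoint. -/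
def MinEndHCov_all : Prop :=
  ∀ (V E : Type) [Fintype V] [DecidableEq V] [Fintype E] [DecidableEq E]
    (ends : E → Sym2 V) (p : E → R), IsProbVec p →
    ∀ (o a₁ a₂ a₃ b : V) (f : E), a₃ ∈ ends f →
      min (Gc (Function.update p f 0) ends o a₁ a₂ a₃ b)
          (Gc (Function.update p f 1) ends o a₁ a₂ a₃ b) ≤ Gc p ends o a₁ a₂ a₃ b

end Row

section Step

variable {V : Type*} {E : Type*} [Fintype E] [DecidableEq E] [Fintype V] [DecidableEq V]
  {R : Type*} [Field R] [LinearOrder R] [IsStrictOrderedRing R]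

variable (p : E → R) (ends : E → Sym2 V) (o a₁ a₂ a₃ b : V) (f : E)

omit [IsStrictOrderedRing R] in
/-- **The one-step reduction for (HMF)**: (MIN-END) at `f` and (HMF) at both ends of the edge give
(HMF). -/
theorem HMF_of_minEnd
    (h : min (HMFc (Function.update p f 0) ends o a₁ a₂ a₃ b)
      (HMFc (Function.update p f 1) ends o a₁ a₂ a₃ b) ≤ HMFc p ends o a₁ a₂ a₃ b)
    (h0 : HMF (Function.update p f 0) ends o a₁ a₂ a₃ b)
    (h1 : HMF (Function.update p f 1) ends o a₁ a₂ a₃ b) : HMF p ends o a₁ a₂ a₃ b := by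
  unfold HMF at h0 h1 ⊢
  exact le_trans (le_min h0 h1) h

omit [Fintype V] [DecidableEq V] [IsStrictOrderedRing R] in
/-- **The one-step reduction for (HCOV)**: (MIN-END) at `f` and (HCOV) at both ends of the edge
give (HCOV). -/
theorem HCov_of_minEnd
    (h : min (Gc (Function.update p f 0) ends o a₁ a₂ a₃ b)
      (Gc (Function.update p f 1) ends o a₁ a₂ a₃ b) ≤ Gc p ends o a₁ a₂ a₃ b)
    (h0 : HCov (Function.update p f 0) ends o a₁ a₂ a₃ b)
    (h1 : HCov (Function.update p f 1) ends o a₁ a₂ a₃ b) : HCov p ends o a₁ a₂ a₃ b := by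
  unfold HCov at h0 h1 ⊢
  exact le_trans (le_min h0 h1) h

omit [LinearOrder R] [IsStrictOrderedRing R] in
/-- Along an edge at `a₃` the mean field is a cubic polynomial in the weight: the explicit form
`HMFc(p) = HMFc(p[f ↦ 0]) + q · c₁ + q² · c₂ + q³ · c₃` is not needed here; this records only that the
mean-field term is affine (`XhatPin.Xhat_eq_pin`), the input of the (MIN-END) normal forms. -/
lemma Xhat_eq_pin' (hf : a₃ ∈ ends f) :
    Xhat p ends o a₁ a₂ a₃ b =
      p f * Xhat (Function.update p f 1) ends o a₁ a₂ a₃ b +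
        (1 - p f) * Xhat (Function.update p f 0) ends o a₁ a₂ a₃ b :=
  XhatPin.Xhat_eq_pin p ends o a₁ a₂ a₃ b hf

end Step

end MinEnd

end Summit.Ventures.PercRepro2
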